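import Mathlib.Analysis.Calculus.ParametricIntegral
import Mathlib.Analysis.Complex.CauchyIntegral
import Mathlib.Analysis.SpecialFunctions.Log.Basic
import Mathlib.Analysis.Convex.SpecificFunctions.Basic
import Mathlib.MeasureTheory.Function.SpecialFunctions.Basic
import Mathlib.MeasureTheory.Integral.Bochner.ContinuousLinearMap
import HarnessLib

/-!
# The kernel `λ^{1+iz̄…}`: analytic interpolation between `λ ((2−λ)/λ)^{−it}` and `(2−λ)((2−λ)/λ)^{−it}`

This file supplies the scalar analytic input for the KMS (modular) condition of the modular
group `Δ^{it} = (2 − R)^{it} R^{−it}` of a standard real subspace in Rieffel–van Daele's bounded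
approach to Tomita–Takesaki theory (Pacific J. Math. 69 (1977), §3, Lemma 3.6 and Prop. 3.7:
"for any complex `z` with `Im z ≤ 0` we can define the bounded operator `R^{iz}` … the function
`z ↦ R^{iz}` is strong-operator continuous on `Im z ≤ 0`, analytic on `Im z < 0`, and uniformly
bounded on horizontal strips"; "we can set `f(z) = ⟨(2 − R)^{iz} R^{−iz+1/2} ζ, η⟩`").

Lacking a spectral theorem, we realise the matrix elements of such operator-valued functions as
integrals against the (finite) scalar spectral measures: for a finite Borel measure `μ` on `ℝ`
(carried by `[0, 2]` in the application) we study

`F_μ(z) = ∫ k(z, λ) dμ(λ)`, `k(z, λ) = λ · exp(−i z L(λ))`, `L(λ) = log(2 − λ) − log λ`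

(so `k(t, λ) = λ ((2−λ)/λ)^{−it}` and `k(t + i, λ) = (2 − λ)((2−λ)/λ)^{−it}` for `0 < λ < 2`),
with `λ` clamped to `[0, 2]` and `Im z` clamped to `[0, 1]` outside the strip so that `k` is
globally bounded by `2` (weighted AM–GM / convexity of `exp`).

## Main results

* `kfun`, `norm_kfun_le` (`|k| ≤ 2`), `kfun_eq_khol` (on the closed strip `k` is the entire
  expression `λ e^{−izL}`), `kfun_ofReal`, `kfun_ofReal_add_I` (boundary values).
* `continuous_kIntegral` — `z ↦ ∫ k(z, ·) dμ` is continuous on `ℂ` (dominated convergence);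
* `differentiableOn_kIntegral` — and holomorphic on the open strip `0 < Im z < 1`
  (differentiation under the integral sign, with the bound `|L| λ^{1−y}(2−λ)^y ≤ 4/δ` obtained from
  `|L| ≤ (e^{δL} + e^{−δL})/δ`).

## References
* M. A. Rieffel, A. van Daele, *A bounded operator approach to Tomita–Takesaki theory*, Pacific
  J. Math. 69 (1977) 187–221, Lemma 3.6, Prop. 3.7. [RieffelVandaele1977]
-/

noncomputable section

open Complex MeasureTheory Filter Set Metric
open scoped Real Topology

namespace Literature.Analysis.OperatorTheory

/-! ### Clamps and the logarithmic kernel -/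

/-- Clamp to `[0, 1]`. [folklore] -/
def clamp01 (y : ℝ) : ℝ := max 0 (min 1 y)

/-- Clamp to `[0, 2]`. [folklore] -/
def clamp02 (l : ℝ) : ℝ := max 0 (min 2 l)

/-- `0 ≤ clamp01 y ≤ 1`. [folklore] -/
theorem clamp01_mem (y : ℝ) : clamp01 y ∈ Icc (0 : ℝ) 1 :=
  ⟨le_max_left _ _, max_le zero_le_one (min_le_left _ _)⟩

/-- `0 ≤ clamp02 l ≤ 2`. [folklore] -/
theorem clamp02_mem (l : ℝ) : clamp02 l ∈ Icc (0 : ℝ) 2 :=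
  ⟨le_max_left _ _, max_le zero_le_two (min_le_left _ _)⟩

/-- `clamp01 y = y` on `[0, 1]`. [folklore] -/
theorem clamp01_of_mem {y : ℝ} (hy : y ∈ Icc (0 : ℝ) 1) : clamp01 y = y := by
  rw [clamp01, min_eq_right hy.2, max_eq_right hy.1]

/-- `clamp02 l = l` on `[0, 2]`. [folklore] -/
theorem clamp02_of_mem {l : ℝ} (hl : l ∈ Icc (0 : ℝ) 2) : clamp02 l = l := by
  rw [clamp02, min_eq_right hl.2, max_eq_right hl.1]

/-- `clamp01` is continuous. [folklore] -/
theorem continuous_clamp01 : Continuous clamp01 := by unfold clamp01; fun_prop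

/-- `clamp02` is continuous. [folklore] -/
theorem continuous_clamp02 : Continuous clamp02 := by unfold clamp02; fun_prop

/-- The logarithm `L(λ) = log(2 − λ) − log λ` of `(2 − λ)/λ` (the "modular Hamiltonian" in the
variable `λ ∈ σ(R)`; `Δ = (2 − R)R⁻¹`), with `λ` clamped to `[0, 2]`. [cite: RieffelVandaele1977, §3 (p. 190, 194)] -/
def modLog (l : ℝ) : ℝ := Real.log (2 - clamp02 l) - Real.log (clamp02 l)

/-- `modLog` is Borel measurable. [folklore] -/
theorem measurable_modLog : Measurable modLog :=
  (Real.measurable_log.comp (measurable_const.sub continuous_clamp02.measurable)).sub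
    (Real.measurable_log.comp continuous_clamp02.measurable)

/-- On `(0, 2)`, `λ e^{L(λ)} = 2 − λ`. [folklore] -/
theorem clamp02_mul_exp_modLog {l : ℝ} (hl : l ∈ Ioo (0 : ℝ) 2) :
    clamp02 l * Real.exp (modLog l) = 2 - l := by
  have hc : clamp02 l = l := clamp02_of_mem ⟨hl.1.le, hl.2.le⟩
  rw [modLog, hc, Real.exp_sub, Real.exp_log (by linarith [hl.2]), Real.exp_log hl.1]
  field_simp [hl.1.ne']

/-- **The key bound** `λ e^{c L(λ)} ≤ 2` for `c ∈ [0, 1]` (i.e. `λ^{1−c}(2−λ)^c ≤ 2`; convexity of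
`exp` in `c` reduces to the endpoints `λ ≤ 2`, `λ e^{L} = 2 − λ ≤ 2`). [folklore] -/
theorem clamp02_mul_exp_le {c : ℝ} (hc : c ∈ Icc (0 : ℝ) 1) (l : ℝ) :
    clamp02 l * Real.exp (c * modLog l) ≤ 2 := by
  obtain ⟨h0, h2⟩ := clamp02_mem l
  rcases h0.lt_or_eq with hpos | hzero
  · rcases h2.lt_or_eq with hlt | htwo
    · -- `0 < clamp02 l < 2`: convexity of `exp`
      have hl : clamp02 l = l := by
        have : l ∈ Icc (0 : ℝ) 2 := by
          constructor
          · by_contra h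
            have h' : l < 0 := lt_of_not_ge h
            have : clamp02 l = 0 := by rw [clamp02, max_eq_left]; exact (min_le_right _ _).trans h'.le
            linarith
          · by_contra h
            have h' : 2 < l := lt_of_not_ge h
            have : clamp02 l = 2 := by rw [clamp02, min_eq_left h'.le, max_eq_right zero_le_two]
            linarith
        exact clamp02_of_mem this
      have hconv := convexOn_exp.2 (mem_univ (0 : ℝ)) (mem_univ (modLog l)) (sub_nonneg.2 hc.2) hc.1
        (by ring)
      simp only [smul_eq_mul, mul_zero, zero_add, Real.exp_zero, mul_one] at hconv
      have hend : clamp02 l * Real.exp (modLog l) = 2 - l := clamp02_mul_exp_modLog (by rw [← hl]; exact ⟨hpos, hlt⟩)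
      calc clamp02 l * Real.exp (c * modLog l) ≤ clamp02 l * ((1 - c) + c * Real.exp (modLog l)) := by
            gcongr
        _ = (1 - c) * clamp02 l + c * (clamp02 l * Real.exp (modLog l)) := by ring
        _ = (1 - c) * l + c * (2 - l) := by rw [hend, hl]
        _ ≤ (1 - c) * 2 + c * 2 := by
            gcongr
            · linarith [hc.2]
            · linarith [hl ▸ hlt]
            · exact hc.1
            · linarith [hl ▸ hpos]
        _ = 2 := by ring
    · -- `clamp02 l = 2`: `L = -log 2 ≤ 0`
      have hL : modLog l = -Real.log 2 := by rw [modLog, htwo]; simp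
      rw [htwo, hL]
      have : Real.exp (c * -Real.log 2) ≤ 1 := by
        rw [Real.exp_le_one_iff]
        nlinarith [hc.1, Real.log_pos (by norm_num : (1 : ℝ) < 2)]
      linarith [mul_le_mul_of_nonneg_left this zero_le_two]
  · rw [← hzero]; simp

/-- `|L| ≤ (e^{δL} + e^{−δL})/δ` for `δ > 0`. [folklore] -/
theorem abs_le_exp_add_exp_div {δ : ℝ} (hδ : 0 < δ) (x : ℝ) :
    |x| ≤ (Real.exp (δ * x) + Real.exp (-(δ * x))) / δ := by
  rw [le_div_iff₀ hδ]
  have h1 : δ * |x| ≤ Real.exp (δ * |x|) := by linarith [Real.add_one_le_exp (δ * |x|)]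
  rcases le_total 0 x with hx | hx
  · rw [abs_of_nonneg hx] at h1 ⊢
    linarith [Real.exp_pos (-(δ * x))]
  · rw [abs_of_nonpos hx] at h1 ⊢
    rw [show δ * -x = -(δ * x) by ring] at h1
    linarith [Real.exp_pos (δ * x)]

/-! ### The kernel `k(z, λ)` -/

/-- **The kernel** `k(z, λ) = λ exp(−i z L(λ))` for `0 ≤ Im z ≤ 1`, `0 ≤ λ ≤ 2`, extended to all
`z, λ` by clamping (so that `|k| ≤ 2` everywhere): `k(z, λ) = λ e^{y L} e^{−i x L}` with
`x = Re z`, `y = clamp01 (Im z)`, `λ = clamp02 λ`. [cite: RieffelVandaele1977, Lemma 3.6 and Prop. 3.7] -/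
def kfun (z : ℂ) (l : ℝ) : ℂ :=
  (clamp02 l : ℂ) * (Real.exp (clamp01 z.im * modLog l) : ℂ) *
    Complex.exp (-(I * (z.re : ℂ) * modLog l))

/-- The entire (in `z`) expression `λ exp(−i z L(λ))`. [cite: RieffelVandaele1977, Lemma 3.6] -/
def khol (z : ℂ) (l : ℝ) : ℂ := (clamp02 l : ℂ) * Complex.exp (z * (-(I * modLog l)))

/-- `‖e^{−ixL}‖ = 1` for real `x`. [folklore] -/
theorem norm_exp_neg_I_mul (x L : ℝ) : ‖Complex.exp (-(I * (x : ℂ) * L))‖ = 1 := by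
  rw [show -(I * (x : ℂ) * L) = ((-(x * L) : ℝ) : ℂ) * I by push_cast; ring,
    Complex.norm_exp_ofReal_mul_I]

/-- **`|k(z, λ)| ≤ 2`.** [cite: RieffelVandaele1977, Lemma 3.6] -/
theorem norm_kfun_le (z : ℂ) (l : ℝ) : ‖kfun z l‖ ≤ 2 := by
  rw [kfun, norm_mul, norm_mul, norm_exp_neg_I_mul, mul_one, Complex.norm_real, Complex.norm_real,
    Real.norm_eq_abs, Real.norm_eq_abs, abs_of_nonneg (clamp02_mem l).1, abs_of_pos (Real.exp_pos _)]
  exact clamp02_mul_exp_le (clamp01_mem z.im) l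

/-- `|k(z, λ)| = λ e^{yL}`. [folklore] -/
theorem norm_kfun (z : ℂ) (l : ℝ) : ‖kfun z l‖ = clamp02 l * Real.exp (clamp01 z.im * modLog l) := by
  rw [kfun, norm_mul, norm_mul, norm_exp_neg_I_mul, mul_one, Complex.norm_real, Complex.norm_real,
    Real.norm_eq_abs, Real.norm_eq_abs, abs_of_nonneg (clamp02_mem l).1, abs_of_pos (Real.exp_pos _)]

/-- **On the closed strip `0 ≤ Im z ≤ 1` the kernel is the entire expression** `λ e^{−izL}`.
[cite: RieffelVandaele1977, Lemma 3.6] -/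
theorem kfun_eq_khol {z : ℂ} (hz : z.im ∈ Icc (0 : ℝ) 1) (l : ℝ) : kfun z l = khol z l := by
  rw [kfun, khol, clamp01_of_mem hz, mul_assoc, Complex.ofReal_exp, ← Complex.exp_add]
  congr 2
  conv_rhs => rw [← re_add_im z]
  push_cast
  ring_nf
  rw [I_sq]
  ring

/-- `k` is continuous in `z`. [folklore] -/
theorem continuous_kfun_left (l : ℝ) : Continuous fun z => kfun z l := by
  unfold kfun
  have h1 : Continuous fun z : ℂ => clamp01 z.im := continuous_clamp01.comp Complex.continuous_im
  fun_prop

/-- `k` is Borel measurable in `λ`. [folklore] -/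
theorem measurable_kfun_right (z : ℂ) : Measurable fun l => kfun z l := by
  unfold kfun
  refine ((Complex.measurable_ofReal.comp continuous_clamp02.measurable).mul
    (Complex.measurable_ofReal.comp (Real.measurable_exp.comp (measurable_modLog.const_mul _)))).mul ?_
  exact Complex.measurable_exp.comp ((Complex.measurable_ofReal.comp measurable_modLog).const_mul _).neg

/-- `khol` is Borel measurable in `λ`. [folklore] -/
theorem measurable_khol_right (z : ℂ) : Measurable fun l => khol z l := by
  unfold khol
  exact (Complex.measurable_ofReal.comp continuous_clamp02.measurable).mul
    (Complex.measurable_exp.comp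
      (((Complex.measurable_ofReal.comp measurable_modLog).const_mul I).neg.const_mul z))

/-- `z ↦ khol z λ` is entire with derivative `−i L(λ) khol z λ`. [folklore] -/
theorem hasDerivAt_khol (l : ℝ) (z : ℂ) :
    HasDerivAt (fun w => khol w l) (-(I * modLog l) * khol z l) z := by
  unfold khol
  have h1 : HasDerivAt (fun w : ℂ => w * (-(I * modLog l))) (-(I * modLog l)) z := hasDerivAt_mul_const _
  have h2 := h1.cexp.const_mul (clamp02 l : ℂ)
  exact h2.congr_deriv (by ring)

/-- **Boundary value at real points**: `k(t, λ) = λ e^{−itL(λ)}`. [cite: RieffelVandaele1977, Prop. 3.7] -/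
theorem kfun_ofReal (t l : ℝ) :
    kfun t l = (clamp02 l : ℂ) * Complex.exp (-(I * (t : ℂ) * modLog l)) := by
  rw [kfun, ofReal_im, ofReal_re, show clamp01 0 = 0 from clamp01_of_mem ⟨le_rfl, zero_le_one⟩]
  simp

/-- **Boundary value on `Im z = 1`**: `k(t + i, λ) = λ e^{L(λ)} e^{−itL(λ)}` (`= (2 − λ) e^{−itL}` for
`0 < λ < 2`). [cite: RieffelVandaele1977, Prop. 3.7] -/
theorem kfun_ofReal_add_I (t l : ℝ) :
    kfun (t + I) l = (clamp02 l : ℂ) * (Real.exp (modLog l) : ℂ) * Complex.exp (-(I * (t : ℂ) * modLog l)) := by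
  rw [kfun]
  have him : ((t : ℂ) + I).im = 1 := by simp
  have hre : ((t : ℂ) + I).re = t := by simp
  rw [him, hre, show clamp01 1 = 1 from clamp01_of_mem ⟨zero_le_one, le_rfl⟩, one_mul]

/-- On `(0, 2)`: `k(t + i, λ) = (2 − λ) e^{−itL(λ)}`. [cite: RieffelVandaele1977, Prop. 3.7] -/
theorem kfun_ofReal_add_I_of_mem (t : ℝ) {l : ℝ} (hl : l ∈ Ioo (0 : ℝ) 2) :
    kfun (t + I) l = ((2 - l : ℝ) : ℂ) * Complex.exp (-(I * (t : ℂ) * modLog l)) := by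
  rw [kfun_ofReal_add_I, ← Complex.ofReal_mul, clamp02_mul_exp_modLog hl]

/-! ### The integrals `F_μ(z) = ∫ k(z, λ) dμ(λ)` -/

section Integral

variable (μ : Measure ℝ) [IsFiniteMeasure μ]

/-- The scalar "matrix element" `F_μ(z) = ∫ k(z, λ) dμ(λ)`. [cite: RieffelVandaele1977, Prop. 3.7] -/
def kIntegral (z : ℂ) : ℂ := ∫ l, kfun z l ∂μ

/-- `F_μ` is bounded by `2 μ(ℝ)`. [cite: RieffelVandaele1977, Lemma 3.6] -/
theorem norm_kIntegral_le (z : ℂ) : ‖kIntegral μ z‖ ≤ 2 * μ.real univ := by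
  unfold kIntegral
  calc ‖∫ l, kfun z l ∂μ‖ ≤ ∫ l, ‖kfun z l‖ ∂μ := norm_integral_le_integral_norm _
    _ ≤ ∫ _l, (2 : ℝ) ∂μ := by
        refine integral_mono_of_nonneg (Eventually.of_forall fun _ => norm_nonneg _)
          (integrable_const _) (Eventually.of_forall fun l => norm_kfun_le z l)
    _ = 2 * μ.real univ := by rw [integral_const, smul_eq_mul, mul_comm]

/-- **`F_μ` is continuous** on `ℂ` (dominated convergence, `|k| ≤ 2`). [cite: RieffelVandaele1977, Lemma 3.6] -/
theorem continuous_kIntegral : Continuous (kIntegral μ) := by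
  unfold kIntegral
  refine continuous_of_dominated (bound := fun _ => 2) (fun z => (measurable_kfun_right z).aestronglyMeasurable)
    (fun z => Eventually.of_forall fun l => norm_kfun_le z l) (integrable_const _)
    (Eventually.of_forall fun l => continuous_kfun_left l)

/-- The open strip `0 < Im z < 1`. [cite: RieffelVandaele1977, Prop. 3.7] -/
def strip01 : Set ℂ := {z : ℂ | 0 < z.im ∧ z.im < 1}

/-- The open strip is open. [folklore] -/
theorem isOpen_strip01 : IsOpen strip01 :=
  (isOpen_lt continuous_const Complex.continuous_im).inter (isOpen_lt Complex.continuous_im continuous_const)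

/-- **`F_μ` is holomorphic on the open strip** (differentiation under the integral sign).
[cite: RieffelVandaele1977, Lemma 3.6 and Prop. 3.7] -/
theorem differentiableOn_kIntegral : DifferentiableOn ℂ (kIntegral μ) strip01 := by
  intro z₀ hz₀
  obtain ⟨hy0, hy1⟩ := hz₀
  -- a margin `δ` with `Im z ± 2δ ∈ [0, 1]` on the ball
  set δ : ℝ := min z₀.im (1 - z₀.im) / 3 with hδ
  have hδpos : 0 < δ := by
    rw [hδ]; exact div_pos (lt_min hy0 (by linarith)) (by norm_num)
  have hδ1 : 3 * δ ≤ z₀.im := by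
    rw [hδ]; linarith [min_le_left z₀.im (1 - z₀.im)]
  have hδ2 : 3 * δ ≤ 1 - z₀.im := by
    rw [hδ]; linarith [min_le_right z₀.im (1 - z₀.im)]
  have hball : ∀ z ∈ ball z₀ δ, |z.im - z₀.im| < δ := fun z hz => by
    have h1 : |(z - z₀).im| ≤ ‖z - z₀‖ := abs_im_le_norm _
    rw [mem_ball_iff_norm] at hz
    simpa using lt_of_le_of_lt h1 hz
  have hball_strip : ∀ z ∈ ball z₀ δ, z.im ∈ Icc (0 : ℝ) 1 := fun z hz => by
    have := abs_lt.1 (hball z hz)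
    constructor <;> linarith
  -- on the ball `kfun = khol`
  have heq : kIntegral μ =ᶠ[𝓝 z₀] fun z => ∫ l, khol z l ∂μ := by
    filter_upwards [ball_mem_nhds z₀ hδpos] with z hz
    unfold kIntegral
    congr 1; ext l
    exact kfun_eq_khol (hball_strip z hz) l
  -- differentiate `∫ khol` under the integral sign
  have key := hasDerivAt_integral_of_dominated_loc_of_deriv_le (μ := μ) (x₀ := z₀)
    (F := fun z l => khol z l) (F' := fun z l => -(I * modLog l) * khol z l) (bound := fun _ => 4 / δ)
    (ball_mem_nhds z₀ hδpos)
    (Eventually.of_forall fun z => (measurable_khol_right z).aestronglyMeasurable) ?_ ?_ ?_ ?_ ?_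
  · exact (key.2.differentiableAt.congr_of_eventuallyEq heq).differentiableWithinAt
  · -- integrability at `z₀`: `khol z₀ = kfun z₀`, bounded
    refine Integrable.mono' (integrable_const (2 : ℝ)) (measurable_khol_right z₀).aestronglyMeasurable
      (Eventually.of_forall fun l => ?_)
    rw [← kfun_eq_khol ⟨hy0.le, hy1.le⟩]
    exact norm_kfun_le z₀ l
  · exact ((Complex.measurable_ofReal.comp measurable_modLog).const_mul I |>.neg.mul
      (measurable_khol_right z₀)).aestronglyMeasurable
  · -- the bound `|L| λ e^{yL} ≤ 4/δ` on the ball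
    refine Eventually.of_forall fun l z hz => ?_
    have hzs := hball_strip z hz
    have hy := abs_lt.1 (hball z hz)
    rw [norm_mul, norm_neg, norm_mul, Complex.norm_I, one_mul, Complex.norm_real, Real.norm_eq_abs,
      ← kfun_eq_khol hzs, norm_kfun, clamp01_of_mem hzs]
    have hL := abs_le_exp_add_exp_div hδpos (modLog l)
    have hc1 : z.im + δ ∈ Icc (0 : ℝ) 1 := ⟨by linarith [hzs.1], by linarith⟩
    have hc2 : z.im - δ ∈ Icc (0 : ℝ) 1 := ⟨by linarith, by linarith [hzs.2]⟩
    have h1 := clamp02_mul_exp_le hc1 l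
    have h2 := clamp02_mul_exp_le hc2 l
    have hpos : 0 ≤ clamp02 l * Real.exp (z.im * modLog l) := mul_nonneg (clamp02_mem l).1 (Real.exp_pos _).le
    calc |modLog l| * (clamp02 l * Real.exp (z.im * modLog l))
        ≤ (Real.exp (δ * modLog l) + Real.exp (-(δ * modLog l))) / δ *
            (clamp02 l * Real.exp (z.im * modLog l)) := by gcongr
      _ = (clamp02 l * Real.exp ((z.im + δ) * modLog l) +
            clamp02 l * Real.exp ((z.im - δ) * modLog l)) / δ := by
          rw [div_mul_eq_mul_div, show (z.im + δ) * modLog l = δ * modLog l + z.im * modLog l by ring,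
            show (z.im - δ) * modLog l = -(δ * modLog l) + z.im * modLog l by ring, Real.exp_add,
            Real.exp_add]
          ring
      _ ≤ (2 + 2) / δ := by gcongr
      _ = 4 / δ := by norm_num
  · exact integrable_const _
  · exact Eventually.of_forall fun l z _ => hasDerivAt_khol l z

end Integral

end Literature.Analysis.OperatorTheory
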